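import Mathlib
import HarnessLib
import Summits.HubbardSuperconductivity.HubbardSuperconductivity.Theorems.KLProgrammeKLRegimeEngineV8PairTransferRelDefsCB

/-!
# Route `KLProgramme` — ENGINE child gen 8 (stmt-HubbardSuperconductivity-20437 `KLRegimeEngineV17F2`), skeleton v2 class #5 «(S)-transfer» rev 3 (RELATIVE family):
# addendum to the cutoff-built index `…EngineV8PairTransferRelDefsCB` (p588716, k3c1-p1 g10) — the two extras the pen named (plan g21 (R54aa)(2); cell gate-hubbard-kl,
# seat hubbard-kl-p1 g13 = class-#5 text owner)

* `isCutoffBuilt_oneSub` — the WICK member `1 − w^K_{Λₙ}` is cutoff-built (index `m := nScales β + 1`: past the thermal index every mode is above the scale,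
  `softSymbolCompl_eq_one_sub_of_nScales_lt`, p588011) — the `m > nScales β` reading the (c) closer and the rev-8′ text use;
* `IsCutoffBuilt.radial` — a cutoff-built symbol is RADIAL in its frame (a function of `ω² + e_K²` through the explicit Gevrey profile `softSymbolCompl_eq_profile`) —
  the composition fact kl-ref's §254 watch reads (the floor slot of `transferBarRelAtF`, p586991, is sound on the whole cutoff-built family);
* `IsCutoffBuilt.nonneg` (pointwise `0 ≤ ψ`, the order hypothesis of the `(ψ | 0)` pair).
The eleven declarations of p588716 are used by name, never restated; the further predicate-level conveniences of the text owner's draft (`.exists_succ`, `.isSoftSymbol_sub`,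
`.klSoftMass_sub_le`, `.klShellOverlap_sub_le/_eq_zero_succ`, `.index`, `.pinned_of_hosted`) stay in HOME/p1/…RelDefsCB.draft.lean until a closer names them.
Bookkeeping only; nothing about the model is asserted.  0 kit · 0 lit.
-/

noncomputable section

namespace Summit.HubbardSuperconductivity.HubbardSuperconductivity.Theorems.KLRegimeSplit

set_option linter.dupNamespace false -- summit = problem name (single-conjunct summit), D-0017

open Real Finset Literature.MathematicalPhysics.QuantumLattice Literature.Probability.LatticeModels
open Summit.HubbardSuperconductivity.HubbardSuperconductivity.Theorems.KLProgrammeLegKernels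

variable {L M : ℕ}

/-- **The WICK member is cutoff-built**: `1 − w^K_{Λₙ} = s^K_{n, nScales β + 1}` (`0 < β`, `n ≤ nScales β + 1`; `softSymbolCompl_eq_one_sub_of_nScales_lt`). -/
theorem isCutoffBuilt_oneSub {β : ℝ} (hβ : 0 < β) (μ : ℝ) (K : TrigPolyC4v) {n : ℕ} (hn : n ≤ nScales β + 1) :
    IsCutoffBuilt L M β μ K n (fun k => 1 - hubbardCutoffWeightCT L M β μ K (klScale klE0 n) k) :=
  ⟨nScales β + 1, hn, (softSymbolCompl_eq_one_sub_of_nScales_lt hβ μ K n (Nat.lt_succ_self _)).symm⟩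

/-- **A cutoff-built symbol is RADIAL in its frame**: two modes with the same `ω² + e_K²` carry the same value (`softSymbolCompl_eq_of_radius_eq`, i.e. the explicit
profile `softSymbolCompl_eq_profile`). -/
theorem IsCutoffBuilt.radial {β μ : ℝ} {K : TrigPolyC4v} {n : ℕ} {ψ : FreqMomentum L M → ℝ} (h : IsCutoffBuilt L M β μ K n ψ) {k k' : FreqMomentum L M}
    (hr : matsubaraFreq β M k.1 ^ 2 + nambuXiCT L μ K k.2 ^ 2 = matsubaraFreq β M k'.1 ^ 2 + nambuXiCT L μ K k'.2 ^ 2) : ψ k = ψ k' := by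
  obtain ⟨m, -, rfl⟩ := h
  exact softSymbolCompl_eq_of_radius_eq β μ K n m hr

/-- A cutoff-built symbol is pointwise nonnegative (the order hypothesis of the pinned pair `(ψ | 0)`). -/
theorem IsCutoffBuilt.nonneg {β μ : ℝ} {K : TrigPolyC4v} {n : ℕ} {ψ : FreqMomentum L M → ℝ} (h : IsCutoffBuilt L M β μ K n ψ) (k : FreqMomentum L M) :
    0 ≤ ψ k :=
  ((IsCutoffBuilt.isSoftSymbol h).1 k).1

end Summit.HubbardSuperconductivity.HubbardSuperconductivity.Theorems.KLRegimeSplit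

end
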